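import Mathlib.LinearAlgebra.BilinearForm.Properties
import Mathlib.RepresentationTheory.Basic
import Mathlib.Data.Matrix.Basis
import Mathlib.LinearAlgebra.Matrix.Notation
import Mathlib.LinearAlgebra.Matrix.Symmetric
import Mathlib.Data.Set.Card
import Mathlib.Algebra.Field.ZMod
import HarnessLib

/-!
# Crux C1 `MainConjectureTransportAlignedAtTwo` (stmt-BirchSwinnertonDyer-22296), line `birth`, residual (R2) `stub_lamLawKilford` (Kilford stratum):
# THE SYMMETRIC SOCLE — the kernel form of the mechanism «H12♯» behind the cell's typed candidate `F1Sign2.CopyAlignmentAtTwo`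
# (width seat att-p3 g17; `--supports 22296`; part 1 of 2, part 2 = `…KilfordCopyMultiplicativeLine.lean`)

THEOREMS ONLY (no `def`, no `sorry`, no named fact); pure linear algebra over `𝔽₂ = ZMod 2`, kernel-checked. BSD is not proved by
this; C1 is not closed by this; `CopyAlignmentAtTwo` is not proved by this (it becomes «multiplicity two + three carrier statements +
these theorems», see part 2).

WHAT IS ABSTRACTED (MEMO-imc §10.24 (a)–(c), cell bsd-f1-sign2; REF1-AUDIT §34 «theorem-grade mechanism at r = 2 modulo (γ)»). On the
Kilford stratum (`ρ̄ = E[2]` with image `GL₂(𝔽₂)`, `ρ̄(Frob₂) = 1`) the `𝔪`-torsion `J₀(N)[𝔪] ≅ ρ̄ ⊗ W` has multiplicity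
`r = dim W ≥ 2` (Kilford–Wiese) and the `λ`-law at `2` needs to know WHICH copy `ρ̄ ⊗ w` a curve occupies. H12♯ says: at `r = 2`
the multiplicative part meets every copy in exactly one line, the canonical line, so «aligned at 2 ⟺ same copy». Its inputs are
(W1) Wiese 2007 Prop. 2.2 / Cor. 4.2 (the `𝔪`-torsion of the multiplicative part is `soc(T̄)·x₀`, of dimension `2r − 1 = 3`),
(W3) the `w_N`-twisted Weil pairing (perfect, symmetric, Galois-invariant, Hecke-self-adjoint), MULT2 (`r = 2`), and ONE
observation («the socle acts through SYMMETRIC forms»), of which only the `𝔽₂`-core `F1Sign2.vecMulVec_isSymm_iff_fin_two` was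
kernel-checked. This file and its sequel kernel-check the observation and its consequences in the following ABSTRACT SETTING, which
is exactly the list of axioms a carrier for (W1)/(W3) has to deliver (typer spec, INBOX 2026-08-28T23:46:22Z (ii)):

* `V` a finite-dimensional `𝔽₂`-space with a representation `π` of a group `G` (plays `J₀(N)[2]_𝔪` with `Gal(ℚ̄/ℚ)`);
* `ρ : G →* M₂(𝔽₂)` with the swap `!![0,1;1,0]` and the shear `!![1,1;0,1]` in its range (plays `ρ̄` with image `GL₂(𝔽₂) ≅ S₃`);
* `U ≤ V` `π`-stable and `Ψ : V →ₗ M₂(𝔽₂)` injective on `U`, onto from `U`, with `Ψ (π g u) = ρ g · Ψ u` on `U`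
  (plays MULT2: `U = J₀(N)[𝔪] ≅ ρ̄ ⊗ 𝔽₂²`, the columns of `M₂(𝔽₂)` being copies of `ρ̄`);
* `B` a nondegenerate SYMMETRIC `π`-invariant bilinear form on `V` (plays (W3));
* socle-type operators `τ : V →ₗ V` — image in `U`, `B`-self-adjoint, `π`-equivariant (play `soc(T̄) = T̄[𝔪̄]` acting on `V`).

RESULTS (part 1).
* §0 `𝔽₂` cores by `decide`: `exists_mulVec_eq_zero_or_exists_inverse` (a `2 × 2` matrix over `𝔽₂` kills a non-zero vector or is
  invertible), `eq_of_vecMulVec_eq_vecMulVec` (equal non-zero rank-one matrices have equal row vectors).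
* §1 coordinates: `eq_sum_smul_pre` / `eq_of_map_eq` (`Ψ`-coordinates on `U` through preimages `pre i j` of the elementary matrices),
  **`apply_eq_sum_mul_of_mem`** (`B v u = ∑ B v (pre i j) · (Ψ u)ᵢⱼ` — the dual coordinates `Y(v) := (B v (pre i j))ᵢⱼ`),
  `exists_forall_apply_pre_eq` (`Y` is ONTO `M₂(𝔽₂)`, via `BilinForm.toDual`), `map_eq_zero_of_forall_apply_pre_eq_zero` /
  `map_map_eq_of_forall_apply_pre_eq` (`Ψ ∘ τ` factors through `Y`).
* §2 transport: `apply_rep_pre_eq` (`Y(π g v) = ρ(g⁻¹)ᵀ · Y(v)`), specialised to the swap and the shear.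
* §3 **`exists_isSymm_socleMatrix`**: for every socle-type `τ` there is a SYMMETRIC `S ∈ M₂(𝔽₂)` with `Ψ (τ v) = J · Y(v) · S` for all
  `v` (`J` the swap) — Schur for `ρ̄` done by hand on the generators, symmetry from «`B(u, τ v)` is a symmetric form».
Part 2 (`…KilfordCopyMultiplicativeLine`) adds (W1) as «`M₀ ⊆ {τ m₀}` with `#M₀ = 8`» and concludes: every copy meets `M₀` in
exactly one line, distinct copies in distinct lines, «aligned ⟺ same copy».

References (for the reading, not used in the proofs): G. Wiese, Multiplicities of Galois representations of weight one, Algebra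
Number Theory 1 (2007), Prop. 2.2, Cor. 4.2 [Wiese2007Multiplicities]; L. J. P. Kilford, G. Wiese, On the failure of the Gorenstein
property for Hecke algebras of prime weight, Exp. Math. 17 (2008), Prop. 2.6, Question 1.9 [KilfordWiese2008]; B. H. Gross, A tameness
criterion for Galois representations associated to modular forms (mod p), Duke Math. J. 61 (1990), p. 485 [Gross1990].
-/

set_option autoImplicit false

noncomputable section

-- justification: the `Summit.BirchSwinnertonDyer.BirchSwinnertonDyer.…` path repeats a component (route-file convention)
set_option linter.dupNamespace false

open Matrix

namespace Summit.BirchSwinnertonDyer.BirchSwinnertonDyer.Theorems.AlignedTransportAtTwoKilfordCopySymmetricSocle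

/-! ## §0 The `𝔽₂` cores -/

/-- Over `𝔽₂` every `2 × 2` matrix either kills a non-zero vector or has a two-sided inverse (the adjugate). [folklore] -/
theorem exists_mulVec_eq_zero_or_exists_inverse (A : Matrix (Fin 2) (Fin 2) (ZMod 2)) :
    (∃ w : Fin 2 → ZMod 2, w ≠ 0 ∧ A *ᵥ w = 0) ∨
      ∃ A' : Matrix (Fin 2) (Fin 2) (ZMod 2), A * A' = 1 ∧ A' * A = 1 := by
  have key : ∀ a b c d : ZMod 2,
      (∃ w0 w1 : ZMod 2, (w0 ≠ 0 ∨ w1 ≠ 0) ∧ a * w0 + b * w1 = 0 ∧ c * w0 + d * w1 = 0) ∨ a * d + b * c = 1 := by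
    decide
  rcases key (A 0 0) (A 0 1) (A 1 0) (A 1 1) with ⟨w0, w1, hw, h0, h1⟩ | hdet
  · refine Or.inl ⟨![w0, w1], ?_, ?_⟩
    · intro h0'
      have e0 := congrFun h0' 0
      have e1 := congrFun h0' 1
      simp only [cons_val_zero, cons_val_one, cons_val_fin_one, Pi.zero_apply] at e0 e1
      rcases hw with hw | hw
      · exact hw e0
      · exact hw e1
    · ext i
      fin_cases i <;> simp [mulVec, dotProduct, Fin.sum_univ_two, h0, h1]
  · refine Or.inr ⟨!![A 1 1, A 0 1; A 1 0, A 0 0], ?_, ?_⟩ <;>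
    · ext i j
      fin_cases i <;> fin_cases j <;>
        simp only [mul_apply, Fin.sum_univ_two, of_apply, cons_val', cons_val_zero, cons_val_one, empty_val',
          cons_val_fin_one, Fin.isValue, Fin.zero_eta, Fin.mk_one, one_apply_eq, one_apply_ne, ne_eq,
          one_ne_zero, not_false_eq_true] <;>
        revert hdet <;>
        generalize A 0 0 = a <;> generalize A 0 1 = b <;> generalize A 1 0 = c <;> generalize A 1 1 = d <;>
        revert a b c d <;> decide

/-- Two non-zero rank-one matrices `e·w₁ᵀ = a·w₂ᵀ` over `𝔽₂` have the same row vector: `w₁ = w₂`. [folklore] -/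
theorem eq_of_vecMulVec_eq_vecMulVec (e a w₁ w₂ : Fin 2 → ZMod 2) (he : e ≠ 0) (hw : w₁ ≠ 0)
    (h : vecMulVec e w₁ = vecMulVec a w₂) : w₁ = w₂ := by
  revert e a w₁ w₂
  decide

/-! ## §1 Coordinates: `Ψ` on `U`, and the dual coordinates `(B v (pre i j))ᵢⱼ` -/

section Coordinates

variable {V : Type*} [AddCommGroup V] [Module (ZMod 2) V]

/-- If `Ψ` is injective on `U` and `pre i j ∈ U` are preimages of the elementary matrices, every `u ∈ U` is the combination
`∑ (Ψ u)ᵢⱼ • pre i j`. [folklore] -/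
theorem eq_sum_smul_pre (U : Submodule (ZMod 2) V) (Ψ : V →ₗ[ZMod 2] Matrix (Fin 2) (Fin 2) (ZMod 2))
    (hΨinj : ∀ u ∈ U, Ψ u = 0 → u = 0) (pre : Fin 2 → Fin 2 → V) (hpreU : ∀ i j, pre i j ∈ U)
    (hpre : ∀ i j, Ψ (pre i j) = Matrix.single i j 1) {u : V} (hu : u ∈ U) :
    u = ∑ i, ∑ j, Ψ u i j • pre i j := by
  have hz : (∑ i, ∑ j, Ψ u i j • pre i j) ∈ U :=
    U.sum_mem fun i _ => U.sum_mem fun j _ => U.smul_mem _ (hpreU i j)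
  have hΨz : Ψ (∑ i, ∑ j, Ψ u i j • pre i j) = Ψ u := by
    simp only [map_sum, map_smul, hpre, Matrix.smul_single, smul_eq_mul, mul_one]
    exact (Matrix.matrix_eq_sum_single (Ψ u)).symm
  have h := hΨinj (u - ∑ i, ∑ j, Ψ u i j • pre i j) (U.sub_mem hu hz) (by rw [map_sub, hΨz, sub_self])
  exact sub_eq_zero.mp h

/-- `Ψ` separates the points of `U`. [folklore] -/
theorem eq_of_map_eq (U : Submodule (ZMod 2) V) (Ψ : V →ₗ[ZMod 2] Matrix (Fin 2) (Fin 2) (ZMod 2))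
    (hΨinj : ∀ u ∈ U, Ψ u = 0 → u = 0) {x y : V} (hx : x ∈ U) (hy : y ∈ U) (h : Ψ x = Ψ y) : x = y :=
  sub_eq_zero.mp (hΨinj (x - y) (U.sub_mem hx hy) (by rw [map_sub, h, sub_self]))

/-- THE KEY IDENTITY: for `u ∈ U`, `B v u = ∑ B v (pre i j) · (Ψ u)ᵢⱼ` — on `U`, the functional `B(v, ·)` is the Frobenius
pairing of the dual coordinates `(B v (pre i j))ᵢⱼ` with `Ψ`. [folklore] -/
theorem apply_eq_sum_mul_of_mem (U : Submodule (ZMod 2) V) (Ψ : V →ₗ[ZMod 2] Matrix (Fin 2) (Fin 2) (ZMod 2))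
    (hΨinj : ∀ u ∈ U, Ψ u = 0 → u = 0) (pre : Fin 2 → Fin 2 → V) (hpreU : ∀ i j, pre i j ∈ U)
    (hpre : ∀ i j, Ψ (pre i j) = Matrix.single i j 1) (B : LinearMap.BilinForm (ZMod 2) V) (v : V) {u : V}
    (hu : u ∈ U) : B v u = ∑ i, ∑ j, B v (pre i j) * Ψ u i j := by
  conv_lhs => rw [eq_sum_smul_pre U Ψ hΨinj pre hpreU hpre hu]
  simp only [map_sum, map_smul, smul_eq_mul]
  exact Finset.sum_congr rfl fun i _ => Finset.sum_congr rfl fun j _ => mul_comm _ _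

/-- The dual-coordinate map `v ↦ (B v (pre i j))ᵢⱼ` is ONTO `M₂(𝔽₂)` when `B` is nondegenerate and `V` is finite-dimensional:
the functional `w ↦ ⟪X, Ψ w⟫` is `B(v, ·)` for some `v`. [folklore] -/
theorem exists_forall_apply_pre_eq [FiniteDimensional (ZMod 2) V] (Ψ : V →ₗ[ZMod 2] Matrix (Fin 2) (Fin 2) (ZMod 2))
    (pre : Fin 2 → Fin 2 → V) (hpre : ∀ i j, Ψ (pre i j) = Matrix.single i j 1)
    (B : LinearMap.BilinForm (ZMod 2) V) (hB : B.Nondegenerate) (X : Matrix (Fin 2) (Fin 2) (ZMod 2)) :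
    ∃ v : V, ∀ i j, B v (pre i j) = X i j := by
  let F : V →ₗ[ZMod 2] ZMod 2 :=
    { toFun := fun w => ∑ a, ∑ b, X a b * Ψ w a b
      map_add' := fun w w' => by
        simp only [map_add, Matrix.add_apply, mul_add, Finset.sum_add_distrib]
      map_smul' := fun c w => by
        simp only [map_smul, Matrix.smul_apply, smul_eq_mul, RingHom.id_apply, Finset.mul_sum, mul_left_comm] }
  refine ⟨(B.toDual hB).symm F, fun i j => ?_⟩
  rw [LinearMap.BilinForm.apply_toDual_symm_apply]
  change ∑ a, ∑ b, X a b * Ψ (pre i j) a b = X i j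
  rw [hpre]
  fin_cases i <;> fin_cases j <;> simp [Fin.sum_univ_two, Matrix.single_apply]

/-- A socle-type operator `τ` (`B`-self-adjoint with image in `U`) kills every vector whose dual coordinates vanish
(`B` nondegenerate); hence `Ψ ∘ τ` factors through the dual coordinates. [folklore] -/
theorem map_eq_zero_of_forall_apply_pre_eq_zero (U : Submodule (ZMod 2) V)
    (Ψ : V →ₗ[ZMod 2] Matrix (Fin 2) (Fin 2) (ZMod 2)) (hΨinj : ∀ u ∈ U, Ψ u = 0 → u = 0)
    (pre : Fin 2 → Fin 2 → V) (hpreU : ∀ i j, pre i j ∈ U) (hpre : ∀ i j, Ψ (pre i j) = Matrix.single i j 1)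
    (B : LinearMap.BilinForm (ZMod 2) V) (hB : B.Nondegenerate)
    (τ : V →ₗ[ZMod 2] V) (hτU : ∀ v, τ v ∈ U) (hτadj : ∀ x y, B (τ x) y = B x (τ y))
    {d : V} (hd : ∀ i j, B d (pre i j) = 0) : τ d = 0 := by
  refine hB.1 (τ d) fun y => ?_
  rw [hτadj, apply_eq_sum_mul_of_mem U Ψ hΨinj pre hpreU hpre B d (hτU y)]
  simp [hd]

/-- Corollary: vectors with the same dual coordinates have the same image under `Ψ ∘ τ`. [folklore] -/
theorem map_map_eq_of_forall_apply_pre_eq (U : Submodule (ZMod 2) V)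
    (Ψ : V →ₗ[ZMod 2] Matrix (Fin 2) (Fin 2) (ZMod 2)) (hΨinj : ∀ u ∈ U, Ψ u = 0 → u = 0)
    (pre : Fin 2 → Fin 2 → V) (hpreU : ∀ i j, pre i j ∈ U) (hpre : ∀ i j, Ψ (pre i j) = Matrix.single i j 1)
    (B : LinearMap.BilinForm (ZMod 2) V) (hB : B.Nondegenerate)
    (τ : V →ₗ[ZMod 2] V) (hτU : ∀ v, τ v ∈ U) (hτadj : ∀ x y, B (τ x) y = B x (τ y))
    {v v' : V} (h : ∀ i j, B v (pre i j) = B v' (pre i j)) : Ψ (τ v) = Ψ (τ v') := by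
  have h0 : τ (v - v') = 0 :=
    map_eq_zero_of_forall_apply_pre_eq_zero U Ψ hΨinj pre hpreU hpre B hB τ hτU hτadj
      (fun i j => by rw [LinearMap.BilinForm.sub_left, h, sub_self])
  rw [map_sub, sub_eq_zero] at h0
  rw [h0]

end Coordinates

/-! ## §2 The representation: transport of the dual coordinates -/

section Transport

variable {V : Type*} [AddCommGroup V] [Module (ZMod 2) V] {G : Type*} [Group G]

/-- If `ρ g = s` with `s² = 1` then `ρ g⁻¹ = s`. [folklore] -/
theorem map_inv_eq_of_mul_self (ρ : G →* Matrix (Fin 2) (Fin 2) (ZMod 2)) {g : G}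
    {s : Matrix (Fin 2) (Fin 2) (ZMod 2)} (hg : ρ g = s) (hss : s * s = 1) : ρ g⁻¹ = s := by
  have h : ρ g⁻¹ * ρ g = 1 := by rw [← map_mul, inv_mul_cancel, map_one]
  calc ρ g⁻¹ = ρ g⁻¹ * (ρ g * ρ g) := by rw [hg, hss, mul_one]
    _ = s := by rw [← mul_assoc, h, one_mul, hg]

/-- Transport of the dual coordinates under the representation: `B (π g v) (pre i j) = ∑ₐ ρ(g⁻¹)ₐᵢ · B v (pre a j)`, i.e.
`Y(g·v) = ρ(g⁻¹)ᵀ · Y(v)` — from the `π`-invariance of `B` and the `π/ρ`-equivariance of `Ψ` on `U`. [folklore] -/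
theorem apply_rep_pre_eq (π : Representation (ZMod 2) G V) (ρ : G →* Matrix (Fin 2) (Fin 2) (ZMod 2))
    (U : Submodule (ZMod 2) V) (hπU : ∀ g, ∀ u ∈ U, π g u ∈ U)
    (Ψ : V →ₗ[ZMod 2] Matrix (Fin 2) (Fin 2) (ZMod 2)) (hΨinj : ∀ u ∈ U, Ψ u = 0 → u = 0)
    (hΨπ : ∀ g, ∀ u ∈ U, Ψ (π g u) = ρ g * Ψ u)
    (pre : Fin 2 → Fin 2 → V) (hpreU : ∀ i j, pre i j ∈ U) (hpre : ∀ i j, Ψ (pre i j) = Matrix.single i j 1)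
    (B : LinearMap.BilinForm (ZMod 2) V) (hBπ : ∀ g x y, B (π g x) (π g y) = B x y)
    (g : G) (v : V) (i j : Fin 2) :
    B (π g v) (pre i j) = ∑ a, ρ g⁻¹ a i * B v (pre a j) := by
  have h1 : B (π g v) (pre i j) = B v (π g⁻¹ (pre i j)) := by
    conv_lhs => rw [← hBπ g⁻¹ (π g v) (pre i j)]
    rw [← Module.End.mul_apply, ← map_mul, inv_mul_cancel, map_one, Module.End.one_apply]
  rw [h1, apply_eq_sum_mul_of_mem U Ψ hΨinj pre hpreU hpre B v (hπU _ _ (hpreU i j)), hΨπ _ _ (hpreU i j), hpre]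
  refine Finset.sum_congr rfl fun a _ => ?_
  fin_cases i <;> fin_cases j <;> simp [Fin.sum_univ_two, Matrix.mul_apply, Matrix.single_apply, mul_comm]

/-- The swap `s = !![0,1;1,0]` exchanges the two rows of the dual coordinates. [folklore] -/
theorem apply_rep_pre_of_swap (π : Representation (ZMod 2) G V) (ρ : G →* Matrix (Fin 2) (Fin 2) (ZMod 2))
    (U : Submodule (ZMod 2) V) (hπU : ∀ g, ∀ u ∈ U, π g u ∈ U)
    (Ψ : V →ₗ[ZMod 2] Matrix (Fin 2) (Fin 2) (ZMod 2)) (hΨinj : ∀ u ∈ U, Ψ u = 0 → u = 0)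
    (hΨπ : ∀ g, ∀ u ∈ U, Ψ (π g u) = ρ g * Ψ u)
    (pre : Fin 2 → Fin 2 → V) (hpreU : ∀ i j, pre i j ∈ U) (hpre : ∀ i j, Ψ (pre i j) = Matrix.single i j 1)
    (B : LinearMap.BilinForm (ZMod 2) V) (hBπ : ∀ g x y, B (π g x) (π g y) = B x y)
    {g : G} (hg : ρ g = !![0, 1; 1, 0]) (v : V) (j : Fin 2) :
    B (π g v) (pre 0 j) = B v (pre 1 j) ∧ B (π g v) (pre 1 j) = B v (pre 0 j) := by
  have hss : (!![0, 1; 1, 0] : Matrix (Fin 2) (Fin 2) (ZMod 2)) * !![0, 1; 1, 0] = 1 := by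
    ext i j; fin_cases i <;> fin_cases j <;> simp [Matrix.mul_apply, Fin.sum_univ_two]
  have hinv := map_inv_eq_of_mul_self ρ hg hss
  constructor <;>
  · rw [apply_rep_pre_eq π ρ U hπU Ψ hΨinj hΨπ pre hpreU hpre B hBπ, hinv, Fin.sum_univ_two]
    simp

/-- The shear `t = !![1,1;0,1]` fixes the first row of the dual coordinates and adds it to the second. [folklore] -/
theorem apply_rep_pre_of_shear (π : Representation (ZMod 2) G V) (ρ : G →* Matrix (Fin 2) (Fin 2) (ZMod 2))
    (U : Submodule (ZMod 2) V) (hπU : ∀ g, ∀ u ∈ U, π g u ∈ U)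
    (Ψ : V →ₗ[ZMod 2] Matrix (Fin 2) (Fin 2) (ZMod 2)) (hΨinj : ∀ u ∈ U, Ψ u = 0 → u = 0)
    (hΨπ : ∀ g, ∀ u ∈ U, Ψ (π g u) = ρ g * Ψ u)
    (pre : Fin 2 → Fin 2 → V) (hpreU : ∀ i j, pre i j ∈ U) (hpre : ∀ i j, Ψ (pre i j) = Matrix.single i j 1)
    (B : LinearMap.BilinForm (ZMod 2) V) (hBπ : ∀ g x y, B (π g x) (π g y) = B x y)
    {g : G} (hg : ρ g = !![1, 1; 0, 1]) (v : V) (j : Fin 2) :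
    B (π g v) (pre 0 j) = B v (pre 0 j) ∧ B (π g v) (pre 1 j) = B v (pre 0 j) + B v (pre 1 j) := by
  have htt : (!![1, 1; 0, 1] : Matrix (Fin 2) (Fin 2) (ZMod 2)) * !![1, 1; 0, 1] = 1 := by
    ext i j; fin_cases i <;> fin_cases j <;> simp [Matrix.mul_apply, Fin.sum_univ_two]; decide
  have hinv := map_inv_eq_of_mul_self ρ hg htt
  constructor <;>
  · rw [apply_rep_pre_eq π ρ U hπU Ψ hΨinj hΨπ pre hpreU hpre B hBπ, hinv, Fin.sum_univ_two]
    simp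

end Transport

/-! ## §3 The symmetric socle: `Ψ (τ v) = J · Y(v) · S_τ` with `S_τ` SYMMETRIC -/

section Socle

variable {V : Type*} [AddCommGroup V] [Module (ZMod 2) V] [FiniteDimensional (ZMod 2) V] {G : Type*} [Group G]

/-- **The symmetric socle.** For a socle-type operator `τ` (image in `U`, `B`-self-adjoint, `π`-equivariant) there is a
SYMMETRIC matrix `S` with `Ψ (τ v) = J · Y(v) · S` for every `v`, `J = !![0,1;1,0]`, `Y(v) = (B v (pre i j))ᵢⱼ` — in entries
`Ψ (τ v) 0 l = ∑ⱼ B v (pre 1 j) · S j l` and `Ψ (τ v) 1 l = ∑ⱼ B v (pre 0 j) · S j l`. Mechanism (MEMO-imc §10.24 (c), «H12♯»):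
`Ψ ∘ τ` factors through the dual coordinates and is (contragredient → standard)-equivariant for `GL₂(𝔽₂)` (the swap and the shear
generate), hence is `Y ↦ J Y S` by Schur for `ρ̄`; `S` is symmetric because `B(u, τ v)` is a symmetric form (`B` symmetric, `τ`
self-adjoint). [folklore] -/
theorem exists_isSymm_socleMatrix (π : Representation (ZMod 2) G V) (ρ : G →* Matrix (Fin 2) (Fin 2) (ZMod 2))
    {gs gt : G} (hgs : ρ gs = !![0, 1; 1, 0]) (hgt : ρ gt = !![1, 1; 0, 1])
    (U : Submodule (ZMod 2) V) (hπU : ∀ g, ∀ u ∈ U, π g u ∈ U)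
    (Ψ : V →ₗ[ZMod 2] Matrix (Fin 2) (Fin 2) (ZMod 2)) (hΨinj : ∀ u ∈ U, Ψ u = 0 → u = 0)
    (hΨπ : ∀ g, ∀ u ∈ U, Ψ (π g u) = ρ g * Ψ u)
    (pre : Fin 2 → Fin 2 → V) (hpreU : ∀ i j, pre i j ∈ U) (hpre : ∀ i j, Ψ (pre i j) = Matrix.single i j 1)
    (B : LinearMap.BilinForm (ZMod 2) V) (hB : B.Nondegenerate) (hBsymm : ∀ x y, B x y = B y x)
    (hBπ : ∀ g x y, B (π g x) (π g y) = B x y)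
    (τ : V →ₗ[ZMod 2] V) (hτU : ∀ v, τ v ∈ U) (hτadj : ∀ x y, B (τ x) y = B x (τ y))
    (hτπ : ∀ g v, τ (π g v) = π g (τ v)) :
    ∃ S : Matrix (Fin 2) (Fin 2) (ZMod 2), S.IsSymm ∧ ∀ (v : V) (l : Fin 2),
      Ψ (τ v) 0 l = ∑ j, B v (pre 1 j) * S j l ∧ Ψ (τ v) 1 l = ∑ j, B v (pre 0 j) * S j l := by
  -- `v₁ j`: a vector with dual coordinates `E_{1j}`; `P j := Ψ (τ (v₁ j))`; `S j l := P j 0 l`.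
  have hsec := fun j => exists_forall_apply_pre_eq Ψ pre hpre B hB (Matrix.single 1 j 1)
  choose v₁ hv₁ using hsec
  have factor := fun {v v' : V} (h : ∀ i j, B v (pre i j) = B v' (pre i j)) =>
    map_map_eq_of_forall_apply_pre_eq U Ψ hΨinj pre hpreU hpre B hB τ hτU hτadj h
  -- (t) shear invariance: the second row of `P j` vanishes
  have hrow : ∀ j l, Ψ (τ (v₁ j)) 1 l = 0 := by
    intro j l
    have hY : ∀ a b, B (π gt (v₁ j)) (pre a b) = B (v₁ j) (pre a b) := by
      intro a b
      obtain ⟨h0, h1⟩ := apply_rep_pre_of_shear π ρ U hπU Ψ hΨinj hΨπ pre hpreU hpre B hBπ hgt (v₁ j) b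
      fin_cases a
      · exact h0
      · simp only [Fin.mk_one, Fin.isValue, h1, hv₁, add_eq_right]
        simp
    have hΨeq := factor hY
    rw [hτπ, hΨπ _ _ (hτU _), hgt] at hΨeq
    have e := congrFun (congrFun hΨeq 0) l
    simp only [Matrix.mul_apply, Fin.sum_univ_two, of_apply, cons_val', cons_val_zero, cons_val_one, empty_val',
      cons_val_fin_one, one_mul, Fin.isValue] at e
    -- e : Ψ (τ (v₁ j)) 0 l + Ψ (τ (v₁ j)) 1 l = Ψ (τ (v₁ j)) 0 l
    simpa using e
  -- (s) swap: `u₀ j := π gs (v₁ j)` has dual coordinates `E_{0j}` and `Ψ (τ (u₀ j)) = J · P j`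
  have hu₀Y : ∀ j b, B (π gs (v₁ j)) (pre 0 b) = (if j = b then 1 else 0) ∧ B (π gs (v₁ j)) (pre 1 b) = 0 := by
    intro j b
    obtain ⟨h0, h1⟩ := apply_rep_pre_of_swap π ρ U hπU Ψ hΨinj hΨπ pre hpreU hpre B hBπ hgs (v₁ j) b
    rw [h0, h1, hv₁, hv₁]
    constructor
    · simp [Matrix.single_apply]
    · simp
  have hu₀Ψ : ∀ j l, Ψ (τ (π gs (v₁ j))) 0 l = 0 ∧ Ψ (τ (π gs (v₁ j))) 1 l = Ψ (τ (v₁ j)) 0 l := by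
    intro j l
    rw [hτπ, hΨπ _ _ (hτU _), hgs]
    simp [Matrix.mul_apply, Fin.sum_univ_two, hrow]
  refine ⟨Matrix.of fun j l => Ψ (τ (v₁ j)) 0 l, ?_, ?_⟩
  · -- symmetry: `B (v₁ b) (τ (u₀ d))` computed directly and through `B`-symmetry + self-adjointness
    refine Matrix.IsSymm.ext fun d b => ?_
    simp only [of_apply]
    have lhs : B (v₁ b) (τ (π gs (v₁ d))) = Ψ (τ (v₁ d)) 0 b := by
      rw [apply_eq_sum_mul_of_mem U Ψ hΨinj pre hpreU hpre B _ (hτU _)]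
      simp only [Fin.sum_univ_two, hv₁, (hu₀Ψ d _).1, (hu₀Ψ d _).2, Fin.isValue]
      fin_cases b <;> simp
    have rhs : B (v₁ b) (τ (π gs (v₁ d))) = Ψ (τ (v₁ b)) 0 d := by
      rw [hBsymm, hτadj, apply_eq_sum_mul_of_mem U Ψ hΨinj pre hpreU hpre B _ (hτU _)]
      simp only [Fin.sum_univ_two, (hu₀Y d _).1, (hu₀Y d _).2, hrow, Fin.isValue]
      fin_cases d <;> simp
    rw [← lhs, ← rhs]
  · intro v l
    -- replace `v` by the combination `v'` of the `u₀ j`, `v₁ j` with the same dual coordinates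
    set v' : V := ∑ j, B v (pre 0 j) • π gs (v₁ j) + ∑ j, B v (pre 1 j) • v₁ j with hv'
    have hY : ∀ a b, B v (pre a b) = B v' (pre a b) := by
      intro a b
      rw [hv', LinearMap.BilinForm.add_left, LinearMap.BilinForm.sum_left, LinearMap.BilinForm.sum_left]
      simp only [LinearMap.BilinForm.smul_left, Fin.sum_univ_two, hv₁, Fin.isValue]
      fin_cases a
      · simp only [(hu₀Y _ _).1, Fin.zero_eta, Fin.isValue]
        fin_cases b <;> simp
      · simp only [(hu₀Y _ _).2, Fin.mk_one, Fin.isValue]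
        fin_cases b <;> simp
    rw [factor hY, hv']
    simp only [map_add, map_smul, Matrix.add_apply, Matrix.smul_apply, smul_eq_mul,
      Fin.sum_univ_two, (hu₀Ψ _ _).1, (hu₀Ψ _ _).2, hrow, of_apply, Fin.isValue]
    constructor <;> ring

end Socle

end Summit.BirchSwinnertonDyer.BirchSwinnertonDyer.Theorems.AlignedTransportAtTwoKilfordCopySymmetricSocle

end
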